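import Mathlib.Probability.Kernel.Composition.MeasureCompProd
import Literature.Analysis.FunctionSpaces.PointConfigVagueTopology
import Literature.Analysis.FluidPDE.RootedLocalState
import HarnessLib

/-!
# The Palm frame for local states of hard-sphere systems, I: Palm laws and the admissible class

Topic `Literature/Analysis/FluidPDE`; definition request `defn-PalmLocalState` (route `PesinPricing` of
`Summits/AtomisticToContinuum/HydrodynamicLimit`, crux `KiferYoungUpperR` — a large-deviation upper
bound over local-weakly CLOSED sets of laws of particle-rooted local states with an infimum over a
Palm-stationary class; also `PricedBoltzmannHypothesis`, `URegularLimits`). Parts (b) and (d) of the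
request; part (a) (vague / local weak topology) is
`Literature/Analysis/FunctionSpaces/PointConfigVagueTopology.lean`, part (c) (the rooted space-time
empirical local state of a finite orbit) is `RootedLocalState.lean`.

## Contents (phase space `ℝᵈ × ℝᵈ`, configurations `PointConfig (ℝᵈ × ℝᵈ)`, shifts act on positions)

* `recentre (ω, p) = ω - (x_p, 0)`: the configuration seen from its particle `p = (x_p, v_p)`
  (moved to the origin, velocities kept); `measurable_recentre` (from
  `PointConfig.measurable_translate_prod`, Last–Penrose Lemma 9.2).
* `palmLaw P`: the PALM LAW of a law `P` on configurations,
  `palmLaw P (A) = (intensity P)⁻¹ · E_P #{p ∈ ω : x_p ∈ [0,1)ᵈ, ω - (x_p, 0) ∈ A}`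
  (Last–Penrose (9.4) with `B = [0,1)ᵈ`; Kallenberg Ch. 11 (1); Georgii–Zessin 1993 (2.4): the
  marked case, shifts in the position coordinate only), realised as the push-forward under
  `recentre` of the Campbell measure `C_P = P ⊗ₘ PointConfig.countKernel` (`C_P(dω, dp) =
  P(dω) ω(dp)`; literally the expression `PointProcess.campbellMeasure P` of
  `Literature/MathematicalPhysics/KineticTheory/OneSphereHopfProperty.lean`, which is not imported so
  that the Palm frame of the hard-sphere gas does not depend on the rotor-gas files) restricted to
  `{x_p ∈ [0,1)ᵈ}` and normalised by the intensity `Literature.Analysis.FluidPDE.intensity P`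
  (expected number of particles in `[0,1)ᵈ × ℝᵈ`). For translation-invariant `P` with
  `0 < intensity P < ∞` this is the Palm distribution `P⁰`; the definition is total (any `P`).
  Proved: `palmLaw_apply` ((9.4)), `lintegral_palmLaw` ((9.5) / G–Z (2.4)),
  `isProbabilityMeasure_palmLaw`, `palmLaw_ae_isRooted` ((9.7): carried by configurations with a
  particle at the origin), `lintegral_windowSum_zero_palmLaw` (the Palm mark law is the normalised
  mark intensity, G–Z (2.5)) and its case `lintegral_rootKineticEnergy_palmLaw`:
  `E_{P⁰}[|v_root|²/2] = kineticEnergyDensity P / intensity P` (PROVED, for `P` a.s. hard-core;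
  requested as a named fact).
* (from `RootedLocalState.lean`, imported) `IsRooted ω` (`∃ v, (0, v) ∈ ω`), `rootVelocity ω`,
  `rootKineticEnergy ω = ∑_{(0,v) ∈ ω} |v|²/2 ∈ [0,∞]` and the window-sum API.
* `IsPointStationary Q`: Mecke's integral (mass-transport) identity for laws of rooted marked
  configurations, shifts by the positions of the particles (the intrinsic property characterising
  Palm measures of stationary laws, Mecke 1967 Satz 2.5; Heveling–Last 2005; the `PointConfig` twin
  of `Literature.Probability.Process.IsPointStationaryLaw`).
* Named fact `PalmUniqueness` (Kallenberg Prop. 11.3; Last–Penrose Thm. 9.6, (9.17)–(9.18)): a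
  translation-invariant law is determined by its intensity and its Palm law.
* `IsPalmHardSphereState σ e₀ Q` (d = 3): THE ROUTE'S ADMISSIBLE CLASS `𝓛(σ, e₀)` as a plain
  predicate — `Q` is the Palm law of a translation-invariant probability law `P` of intensity `σ³`,
  a.s. hard-core at diameter `1`, a.e.-defined and stationary for some infinite hard-sphere flow
  `InfiniteHardSphereFlow (Fin 3) 1`, with `E_Q[|v_root|²/2] ≤ e₀`; and the path-space ALTERNATIVE
  `IsPalmHardSphereTrajectoryState σ e₀ Q` (time-zero Palm marginal of a translation-invariant,
  time-shift-stationary law on configuration paths carried by infinite hard-sphere trajectories with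
  finite collision clusters). WHICH TO QUOTE: route items should quote `IsPalmHardSphereState` — the
  infinite-volume defect densities of `defn-InfiniteVolumePesinDefect` (the rate `i(Q)`) are
  functions of a pair `(Φ, P)` with `Φ.IsStationary P`, exactly the data of the flow form; the path
  form is offered for intermediate "limit points lie in the class" statements and is neither weaker
  nor stronger as stated (it asks finite clusters, the flow form asks a measurable flow structure).

## Design choices

* `palmLaw` normalises by `intensity P` with Mathlib's `⁻¹` on `ℝ≥0∞` (junk: `0⁻¹ = ∞`, `∞⁻¹ = 0`);
  all statements of substance assume `intensity P ≠ 0, ≠ ∞`. It is a genuine push-forward (no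
  measurability junk): `recentre` is jointly measurable.
* The root's velocity enters the class predicate through `rootKineticEnergy` (an `ℝ≥0∞`-valued
  point functional, measurable, no junk) rather than through `rootVelocity` (a classical choice);
  the two agree on hard-core rooted configurations, which carry every intended `Q`.
* `IsPointStationary` lets the transported mass depend on the configuration and on the POSITION of
  the receiving particle; on configurations with distinct positions (hard core) this is equivalent
  to letting it depend on the full phase point (the velocity is a function of the position and the
  configuration).
* Deliberately NOT here: Mecke's characterisation "`Q` is the Palm law of a stationary `P` iff `Q` is
  point-stationary" for MARKED processes (Mecke 1967 treats random measures stationary under the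
  whole group; the marked version is Matthes–Kerstan–Mecke 1978 / Daley–Vere-Jones II Ch. 13, not
  held — to be vendored as a cite item when the source is in hand); the environment-seen-from-the-
  root dynamics; any claim that limit points of rooted local states of finite systems lie in
  `IsPalmHardSphereState` (the route's item `LimitPointsInClass`).

## References

* G. Last, M. Penrose, *Lectures on the Poisson Process* (2017), Thm. 9.1 (refined Campbell),
  Lemma 9.2, Def. 9.3, (9.4)–(9.7), Thm. 9.6, (9.17)–(9.18), Prop. 9.7.
* O. Kallenberg, *Foundations of Modern Probability* (held copy), Ch. 11: (1) (Palm distribution),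
  Lemma 11.2, Prop. 11.3 (uniqueness and inversion).
* H.-O. Georgii, H. Zessin, PTRF 96 (1993), §2.1 Remark 2.1 (2.3)–(2.5), Remark 2.2–2.3.
* J. Mecke, Z. Wahrsch. 9 (1967), Satz 2.3–2.5; M. Heveling, G. Last, Ann. Probab. 33 (2005).
* S. Olla, S. R. S. Varadhan, H.-T. Yau, CMP 155 (1993), §3 (p. 535), §4 (4.1), Lemma 4.1.
-/

noncomputable section

open MeasureTheory Set Filter Function
open scoped ENNReal Topology ProbabilityTheory
open Literature.Analysis.FunctionSpaces

namespace Literature.Analysis.FluidPDE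

section Palm

variable {d : Type*} [Fintype d]

local notation "𝔼" => EuclideanSpace ℝ d

/-! ## Re-rooting and the Palm law -/

/-- The configuration `ω` SEEN FROM ITS PARTICLE `p = (x_p, v_p)`: translate all positions by
`-x_p` (the particle goes to the origin, velocities are kept), `θ_{x_p} ω = ω - (x_p, 0)`
(Last–Penrose 2017 §9.1, `θ_x μ`; Georgii–Zessin 1993 §2.1, `ϑ_x ω`). [cite: LastPenrose2017, §9.1] -/
def recentre (q : PointConfig (𝔼 × 𝔼) × (𝔼 × 𝔼)) : PointConfig (𝔼 × 𝔼) :=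
  q.1.translate (-q.2.1, 0)

/-- Unfolding `recentre`. [folklore] -/
theorem recentre_apply (ω : PointConfig (𝔼 × 𝔼)) (p : 𝔼 × 𝔼) :
    recentre (ω, p) = ω.translate (-p.1, 0) :=
  rfl

/-- The points of the recentred configuration. [folklore] -/
theorem mem_recentre_iff {ω : PointConfig (𝔼 × 𝔼)} {p q : 𝔼 × 𝔼} :
    q ∈ recentre (ω, p) ↔ ∃ r ∈ ω, (r.1 - p.1, r.2) = q := by
  change q ∈ (ω.translate (-p.1, 0)).carrier ↔ _
  rw [PointConfig.carrier_translate, mem_image]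
  simp only [PointConfig.mem_carrier, Prod.add_def, add_zero, ← sub_eq_add_neg]

/-- Seen from its particle `p`, the configuration has the particle `(0, v_p)` at the origin.
[folklore] -/
theorem zero_mem_recentre {ω : PointConfig (𝔼 × 𝔼)} {p : 𝔼 × 𝔼} (hp : p ∈ ω) :
    ((0 : 𝔼), p.2) ∈ recentre (ω, p) :=
  mem_recentre_iff.2 ⟨p, hp, by simp⟩

/-- **Re-rooting is jointly measurable** in (configuration, particle) (Last–Penrose 2017
Lemma 9.2). [cite: LastPenrose2017, Lemma 9.2] -/
@[fun_prop]
theorem measurable_recentre : Measurable (recentre (d := d)) :=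
  (measurable_snd.fst.neg.prodMk measurable_const).pointConfig_translate measurable_fst

/-- **The Palm law** of a law `P` on configurations of `ℝᵈ × ℝᵈ` (shifts act on positions):
`palmLaw P (A) = (intensity P)⁻¹ · E_P #{p ∈ ω : x_p ∈ [0,1)ᵈ, ω - (x_p, 0) ∈ A}` — the
push-forward under `recentre` of the Campbell measure `C_P(dω, dp) = P(dω) ω(dp)` restricted to
particles with position in the unit cube, normalised by the intensity (Last–Penrose 2017 (9.4),
Def. 9.3, with `B = [0,1]ᵈ`; Kallenberg Ch. 11 (1); the marked case: Georgii–Zessin 1993 Remark 2.1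
(2.4), "the Palm measure `P⁰` of a stationary marked point random field"). For translation-invariant
`P` with `0 < intensity P < ∞` this is the Palm distribution `P⁰` (any bounded `B` of positive
volume gives the same law, refined Campbell theorem LP Thm. 9.1); the definition is total.
[cite: LastPenrose2017, Def. 9.3 and (9.4)] -/
def palmLaw (P : Measure (PointConfig (𝔼 × 𝔼))) : Measure (PointConfig (𝔼 × 𝔼)) :=
  (intensity P)⁻¹ •
    ((P ⊗ₘ PointConfig.countKernel).restrict {q | q.2.1 ∈ Torus.unitCube d}).map recentre

/-- The Campbell measure `C_P(dω, dp) = P(dω) ω(dp)` of a measurable set: `C_P(B) =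
∫ #{p ∈ ω | (ω, p) ∈ B} P(dω)` (Last–Penrose 2017 §2.2; Mathlib's `Measure.compProd_apply` with the
tree's counting kernel). [cite: LastPenrose2017, §2.2] -/
theorem compProd_countKernel_apply (P : Measure (PointConfig (𝔼 × 𝔼))) [SFinite P]
    {B : Set (PointConfig (𝔼 × 𝔼) × (𝔼 × 𝔼))} (hB : MeasurableSet B) :
    (P ⊗ₘ PointConfig.countKernel) B = ∫⁻ ω, ω.toMeasure (Prod.mk ω ⁻¹' B) ∂P := by
  rw [Measure.compProd_apply hB]
  rfl

/-- Campbell's formula `∫ f dC_P = ∫ ∑_{p ∈ ω} f(ω, p) P(dω)` for measurable `f ≥ 0`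
(Last–Penrose 2017 Prop. 2.7). [cite: LastPenrose2017, Prop 2.7] -/
theorem lintegral_compProd_countKernel (P : Measure (PointConfig (𝔼 × 𝔼))) [SFinite P]
    {f : PointConfig (𝔼 × 𝔼) × (𝔼 × 𝔼) → ℝ≥0∞} (hf : Measurable f) :
    ∫⁻ z, f z ∂(P ⊗ₘ PointConfig.countKernel) =
      ∫⁻ ω, ∑' p : (ω : Set (𝔼 × 𝔼)), f (ω, p) ∂P := by
  rw [Measure.lintegral_compProd hf]
  refine lintegral_congr fun ω => ?_
  rw [PointConfig.countKernel_apply, PointConfig.lintegral_toMeasure]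

/-- The window event "the tagged particle has its position in the unit cube" is measurable.
[folklore] -/
theorem measurableSet_rootWindow :
    MeasurableSet {q : PointConfig (𝔼 × 𝔼) × (𝔼 × 𝔼) | q.2.1 ∈ Torus.unitCube d} :=
  measurable_snd.fst Torus.measurableSet_unitCube

/-- The Campbell measure of the window event is the intensity:
`C_P{x_p ∈ [0,1)ᵈ} = E_P N([0,1)ᵈ × ℝᵈ)`. [folklore] -/
theorem compProd_countKernel_rootWindow (P : Measure (PointConfig (𝔼 × 𝔼))) [SFinite P] :
    (P ⊗ₘ PointConfig.countKernel) {q : PointConfig (𝔼 × 𝔼) × (𝔼 × 𝔼) | q.2.1 ∈ Torus.unitCube d} =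
      intensity P := by
  rw [compProd_countKernel_apply P measurableSet_rootWindow, intensity]
  refine lintegral_congr fun ω => ?_
  have hset : Prod.mk ω ⁻¹' {q : PointConfig (𝔼 × 𝔼) × (𝔼 × 𝔼) | q.2.1 ∈ Torus.unitCube d} =
      Torus.unitCube d ×ˢ (univ : Set 𝔼) := by
    ext p
    simp [mem_prod]
  rw [hset, PointConfig.toMeasure_apply _ (Torus.measurableSet_unitCube.prod MeasurableSet.univ)]

/-- **The Palm law of an event** (Last–Penrose (9.4)): `P⁰(A) = ρ⁻¹ E_P #{p ∈ ω : x_p ∈ [0,1)ᵈ,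
ω - (x_p, 0) ∈ A}`, the count running over the particles in the unit cube from which the
configuration is seen in `A`. [cite: LastPenrose2017, (9.4)] -/
theorem palmLaw_apply (P : Measure (PointConfig (𝔼 × 𝔼))) [SFinite P]
    {A : Set (PointConfig (𝔼 × 𝔼))} (hA : MeasurableSet A) :
    palmLaw P A = (intensity P)⁻¹ *
      ∫⁻ ω, (({p ∈ particlesIn ω (Torus.unitCube d) | ω.translate (-p.1, 0) ∈ A}).encard : ℝ≥0∞) ∂P := by
  rw [palmLaw, Measure.smul_apply, smul_eq_mul, Measure.map_apply measurable_recentre hA,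
    Measure.restrict_apply (measurable_recentre hA),
    compProd_countKernel_apply P ((measurable_recentre hA).inter measurableSet_rootWindow)]
  congr 1
  refine lintegral_congr fun ω => ?_
  have hmeas : MeasurableSet (Prod.mk ω ⁻¹'
      (recentre ⁻¹' A ∩ {q : PointConfig (𝔼 × 𝔼) × (𝔼 × 𝔼) | q.2.1 ∈ Torus.unitCube d})) :=
    measurable_prodMk_left ((measurable_recentre hA).inter measurableSet_rootWindow)
  rw [PointConfig.toMeasure_apply _ hmeas, PointConfig.count]
  have hset : ω.carrier ∩ Prod.mk ω ⁻¹'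
      (recentre ⁻¹' A ∩ {q : PointConfig (𝔼 × 𝔼) × (𝔼 × 𝔼) | q.2.1 ∈ Torus.unitCube d}) =
      {p ∈ particlesIn ω (Torus.unitCube d) | ω.translate (-p.1, 0) ∈ A} := by
    ext p
    simp only [mem_inter_iff, mem_preimage, mem_setOf_eq, mem_particlesIn_iff,
      PointConfig.mem_carrier, recentre_apply]
    tauto
  rw [hset]

/-- **Palm expectations** (Last–Penrose (9.5); Georgii–Zessin (2.4)):
`∫ g dP⁰ = ρ⁻¹ E_P ∑_{p ∈ ω, x_p ∈ [0,1)ᵈ} g(ω - (x_p, 0))` for measurable `g ≥ 0`.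
[cite: LastPenrose2017, (9.5)] -/
theorem lintegral_palmLaw (P : Measure (PointConfig (𝔼 × 𝔼))) [SFinite P]
    {g : PointConfig (𝔼 × 𝔼) → ℝ≥0∞} (hg : Measurable g) :
    ∫⁻ ω, g ω ∂(palmLaw P) = (intensity P)⁻¹ *
      ∫⁻ ω, ∑' p : particlesIn ω (Torus.unitCube d), g (ω.translate (-(p : 𝔼 × 𝔼).1, 0)) ∂P := by
  rw [palmLaw, lintegral_smul_measure, smul_eq_mul, lintegral_map hg measurable_recentre,
    ← lintegral_indicator measurableSet_rootWindow,
    lintegral_compProd_countKernel P (f := {q : PointConfig (𝔼 × 𝔼) × (𝔼 × 𝔼) | q.2.1 ∈ Torus.unitCube d}.indicator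
      fun q => g (recentre q)) ((hg.comp measurable_recentre).indicator measurableSet_rootWindow)]
  congr 1
  refine lintegral_congr fun ω => ?_
  rw [tsum_particlesIn_eq ω (Torus.unitCube d) fun p => g (ω.translate (-p.1, 0))]
  rfl

/-- **The Palm law is a probability law** when the intensity is positive and finite
(Last–Penrose Thm. 9.1: `P⁰(N_l) = γ_{N_l}/γ = 1`). [cite: LastPenrose2017, Thm. 9.1] -/
theorem isProbabilityMeasure_palmLaw (P : Measure (PointConfig (𝔼 × 𝔼))) [SFinite P]
    (h0 : intensity P ≠ 0) (htop : intensity P ≠ ∞) : IsProbabilityMeasure (palmLaw P) := by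
  refine ⟨?_⟩
  rw [palmLaw, Measure.smul_apply, smul_eq_mul, Measure.map_apply measurable_recentre MeasurableSet.univ,
    preimage_univ, Measure.restrict_apply MeasurableSet.univ, univ_inter, compProd_countKernel_rootWindow,
    ENNReal.inv_mul_cancel h0 htop]

/-! ## The Palm law lives on rooted configurations -/

/-- **The Palm law is carried by rooted configurations** (Last–Penrose (9.7); Georgii–Zessin
Remark 2.1): seen from its particle `p`, a configuration has the particle `(0, v_p)` at the origin.
[cite: LastPenrose2017, (9.7)] -/
theorem palmLaw_ae_isRooted (P : Measure (PointConfig (𝔼 × 𝔼))) [SFinite P] :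
    ∀ᵐ ω ∂(palmLaw P), IsRooted ω := by
  rw [ae_iff, show {ω : PointConfig (𝔼 × 𝔼) | ¬IsRooted ω} = {ω | IsRooted ω}ᶜ from rfl,
    palmLaw_apply P measurableSet_isRooted.compl]
  refine mul_eq_zero_of_right _ ?_
  have h : ∀ ω : PointConfig (𝔼 × 𝔼), ({p ∈ particlesIn ω (Torus.unitCube d) |
      ω.translate (-p.1, 0) ∈ {ω : PointConfig (𝔼 × 𝔼) | IsRooted ω}ᶜ}).encard = 0 := by
    intro ω
    rw [Set.encard_eq_zero, Set.eq_empty_iff_forall_notMem]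
    rintro p ⟨hp, hpA⟩
    exact hpA ⟨p.2, zero_mem_recentre hp.1⟩
  simp_rw [h]
  simp

/-- Translating a configuration with distinct positions gives a configuration with distinct
positions. [folklore] -/
theorem injOn_fst_translate {ω : PointConfig (𝔼 × 𝔼)} (h : InjOn Prod.fst (ω : Set (𝔼 × 𝔼)))
    (a : 𝔼) : InjOn Prod.fst ((ω.translate (a, 0) : PointConfig (𝔼 × 𝔼)) : Set (𝔼 × 𝔼)) := by
  intro p' hp' q' hq' hpq
  obtain ⟨p, hp, rfl⟩ := (show p' ∈ (ω.translate (a, 0)).carrier from hp')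
  obtain ⟨q, hq, rfl⟩ := (show q' ∈ (ω.translate (a, 0)).carrier from hq')
  simp only [Prod.fst_add] at hpq
  rw [h hp hq (add_right_cancel hpq)]

/-! ## Palm expectations of the root's marks: the Palm mark law -/

/-- **The Palm mark law is the normalised mark intensity** (Georgii–Zessin 1993 (2.5),
`P⁰(φ ⊗ 1) = z^φ(P)/z(P)`; Last–Penrose (9.5) with `f` a function of the atom at the origin): for a
law `P` a.s. carried by configurations with distinct positions (e.g. hard-core ones) and measurable
`G ≥ 0`, `∫ ∑_{(0,v) ∈ ω} G(0, v) P⁰(dω) = ρ⁻¹ E_P ∑_{(x,v) ∈ ω, x ∈ [0,1)ᵈ} G(0, v)`.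
[cite: GeorgiiZessin1993, §2.1 Remark 2.1 (2.5)] -/
theorem lintegral_windowSum_zero_palmLaw (P : Measure (PointConfig (𝔼 × 𝔼))) [SFinite P]
    (hP : ∀ᵐ ω ∂P, InjOn Prod.fst ((ω : PointConfig (𝔼 × 𝔼)) : Set (𝔼 × 𝔼)))
    {G : 𝔼 × 𝔼 → ℝ≥0∞} (hG : Measurable G) :
    ∫⁻ ω, windowSum ω {0} G ∂(palmLaw P) =
      (intensity P)⁻¹ * ∫⁻ ω, windowSum ω (Torus.unitCube d) (fun p => G (0, p.2)) ∂P := by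
  rw [lintegral_palmLaw P (measurable_windowSum (measurableSet_singleton 0) hG)]
  congr 1
  refine lintegral_congr_ae (hP.mono fun ω hω => ?_)
  show _ = ∑' p : particlesIn ω (Torus.unitCube d), G (0, (p : 𝔼 × 𝔼).2)
  refine tsum_congr fun p => ?_
  exact windowSum_singleton_eq (injOn_fst_translate hω _) (zero_mem_recentre p.2.1) G

/-- **Palm expectation of the root's kinetic energy** (the identity the request lists as a named
fact, PROVED): for a law `P` a.s. hard-core at some diameter `ε > 0`,
`E_{P⁰}[|v_root|²/2] = kineticEnergyDensity P / intensity P` (`ℝ≥0∞` arithmetic: `ρ⁻¹ · e`).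
[cite: GeorgiiZessin1993, §2.1 Remark 2.1 (2.5)] -/
theorem lintegral_rootKineticEnergy_palmLaw (P : Measure (PointConfig (𝔼 × 𝔼))) [SFinite P] {ε : ℝ}
    (hε : 0 < ε) (hP : ∀ᵐ ω ∂P, IsHardCore ε ω) :
    ∫⁻ ω, rootKineticEnergy ω ∂(palmLaw P) = (intensity P)⁻¹ * kineticEnergyDensity P :=
  lintegral_windowSum_zero_palmLaw P (hP.mono fun _ hω => hω.injOn_fst hε) measurable_kineticIntegrand

/-! ## Point-stationarity and uniqueness (Mecke, Kallenberg) -/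

/-- **Point-stationarity** (Mecke's intrinsic integral identity, marked form with shifts by the
POSITIONS of the particles): a law `Q` on (rooted) configurations is point-stationary if for every
jointly measurable `g : PointConfig (ℝᵈ × ℝᵈ) → ℝᵈ → [0, ∞]`,
`∫ ∑_{p ∈ ω} g(ω, x_p) Q(dω) = ∫ ∑_{p ∈ ω} g(ω - (x_p, 0), -x_p) Q(dω)` — the Campbell measure of `Q`
is invariant under re-rooting `(ω, p) ↦ (ω - (x_p, 0), old root)`: "mass sent out of the root equals
mass received at the root". This is the integral equation by which Mecke characterises the Palm
measures of stationary measures [Mecke 1967, Satz 2.5] (for simple point processes on `ℝᵈ` it is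
Thorisson's point-stationarity, Heveling–Last 2005, and the Aldous–Lyons mass-transport principle);
the `PointConfig` twin of `Literature.Probability.Process.IsPointStationaryLaw` (configurations as
measures on a group). No normalisation or rootedness is built in. [cite: Mecke1967, Satz 2.5] -/
def IsPointStationary (Q : Measure (PointConfig (𝔼 × 𝔼))) : Prop :=
  ∀ g : PointConfig (𝔼 × 𝔼) → 𝔼 → ℝ≥0∞, Measurable (Function.uncurry g) →
    ∫⁻ ω, ∑' p : (ω : Set (𝔼 × 𝔼)), g ω (p : 𝔼 × 𝔼).1 ∂Q =
      ∫⁻ ω, ∑' p : (ω : Set (𝔼 × 𝔼)), g (ω.translate (-(p : 𝔼 × 𝔼).1, 0)) (-(p : 𝔼 × 𝔼).1) ∂Q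

/-- Unfolding `IsPointStationary`. [folklore] -/
theorem isPointStationary_iff (Q : Measure (PointConfig (𝔼 × 𝔼))) :
    IsPointStationary Q ↔ ∀ g : PointConfig (𝔼 × 𝔼) → 𝔼 → ℝ≥0∞, Measurable (Function.uncurry g) →
      ∫⁻ ω, ∑' p : (ω : Set (𝔼 × 𝔼)), g ω (p : 𝔼 × 𝔼).1 ∂Q =
        ∫⁻ ω, ∑' p : (ω : Set (𝔼 × 𝔼)), g (ω.translate (-(p : 𝔼 × 𝔼).1, 0)) (-(p : 𝔼 × 𝔼).1) ∂Q :=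
  Iff.rfl

/-- The zero measure is (vacuously) point-stationary. [folklore] -/
theorem IsPointStationary.zero : IsPointStationary (0 : Measure (PointConfig (𝔼 × 𝔼))) := by
  intro g _
  simp only [lintegral_zero_measure]

/-- Point-stationary laws form a convex cone: closure under addition. [folklore] -/
theorem IsPointStationary.add {Q Q' : Measure (PointConfig (𝔼 × 𝔼))} (hQ : IsPointStationary Q)
    (hQ' : IsPointStationary Q') : IsPointStationary (Q + Q') := by
  intro g hg
  simp only [lintegral_add_measure, hQ g hg, hQ' g hg]

/-- Point-stationary laws form a convex cone: closure under scaling. [folklore] -/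
theorem IsPointStationary.smul {Q : Measure (PointConfig (𝔼 × 𝔼))} (c : ℝ≥0∞)
    (hQ : IsPointStationary Q) : IsPointStationary (c • Q) := by
  intro g hg
  simp only [lintegral_smul_measure, hQ g hg]

/-- **Uniqueness in the Palm correspondence** (Kallenberg, *Foundations*, Prop. 11.3 "uniqueness and
inversion": for a stationary pair `(X, ξ)` with intensity in `(0, ∞)`, `P[(X, ξ) ∈ · | ξ ≠ 0]` is
determined by the Palm distribution through the inversion formula
`E[f(X, ξ); ξ ≠ 0] = E ξ̄ · E ∫ f(θ_s(Y, η)) g(-s) / ((θ_s η) g) ds`, and `P{ξ ≠ 0}/E ξ̄` is determined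
too; for simple point processes the Voronoi inversion formula, Last–Penrose Thm. 9.6, (9.17)–(9.18)):
two translation-invariant probability laws on configurations of `ℝᵈ × ℝᵈ` with the same finite
positive intensity and the same Palm law are equal. (Here `X` is the marked configuration as a
measurable process `s ↦ ω - (s, 0)` and `ξ` its ground process of positions, a.s. locally finite
since the intensity is finite.) [cite: Kallenberg2021, Prop. 11.3] -/
def PalmUniqueness : Prop :=
  ∀ P P' : Measure (PointConfig (𝔼 × 𝔼)), IsProbabilityMeasure P → IsProbabilityMeasure P' →
    IsTranslationInvariant P → IsTranslationInvariant P' →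
    intensity P ≠ 0 → intensity P ≠ ∞ → intensity P' = intensity P → palmLaw P' = palmLaw P → P' = P

end Palm

/-! ## The admissible class of the route (`d = 3`, unit diameter) -/

section AdmissibleClass

local notation "V3" => EuclideanSpace ℝ (Fin 3)

/-- **The route's admissible class `𝓛(σ, e₀)`** (a plain predicate — no existence claim inside):
`Q` is a PALM HARD-SPHERE STATE at reduced density `σ` with energy cap `e₀` if it is the Palm law of a
translation-invariant probability law `P` on configurations of `ℝ³ × ℝ³` with intensity `σ³`,
`P`-a.s. hard-core at diameter `1`, for which SOME infinite hard-sphere flow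
`Φ : InfiniteHardSphereFlow (Fin 3) 1` (Alexander's hypothesis structure) is a.e. defined and
stationary, and the Palm expectation of the root's kinetic energy is at most `e₀`:
`E_Q |v_root|²/2 ≤ e₀`. This is the class over which crux `KiferYoungUpperR` takes the infimum of the
Pesin-defect rate; its elements are rooted and hard-core almost surely (`ae_isRooted`). ROUTE ITEMS
SHOULD QUOTE THIS FORM (module docstring: the defect densities of `defn-InfiniteVolumePesinDefect`
are functions of such a pair `(Φ, P)`); the path-space alternative is
`IsPalmHardSphereTrajectoryState`. [folklore] -/
def IsPalmHardSphereState (σ e₀ : ℝ) (Q : Measure (PointConfig (V3 × V3))) : Prop :=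
  ∃ P : Measure (PointConfig (V3 × V3)), IsProbabilityMeasure P ∧ IsTranslationInvariant P ∧
    intensity P = ENNReal.ofReal (σ ^ 3) ∧ (∀ᵐ ω ∂P, IsHardCore 1 ω) ∧
    (∃ Φ : InfiniteHardSphereFlow (Fin 3) 1, Φ.IsAEDefined P ∧ Φ.IsStationary P) ∧
    Q = palmLaw P ∧ ∫⁻ ω, rootKineticEnergy ω ∂Q ≤ ENNReal.ofReal e₀

namespace IsPalmHardSphereState

variable {σ e₀ : ℝ} {Q : Measure (PointConfig (EuclideanSpace ℝ (Fin 3) × EuclideanSpace ℝ (Fin 3)))}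

/-- A Palm hard-sphere state at positive reduced density is a probability law. [folklore] -/
theorem isProbabilityMeasure (h : IsPalmHardSphereState σ e₀ Q) (hσ : 0 < σ) :
    IsProbabilityMeasure Q := by
  obtain ⟨P, hP, -, hρ, -, -, rfl, -⟩ := h
  refine isProbabilityMeasure_palmLaw P ?_ ?_
  · rw [hρ]
    exact (ENNReal.ofReal_pos.2 (pow_pos hσ 3)).ne'
  · rw [hρ]
    exact ENNReal.ofReal_ne_top

/-- A Palm hard-sphere state is carried by rooted configurations. [folklore] -/
theorem ae_isRooted (h : IsPalmHardSphereState σ e₀ Q) : ∀ᵐ ω ∂Q, IsRooted ω := by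
  obtain ⟨P, hP, -, -, -, -, rfl, -⟩ := h
  exact palmLaw_ae_isRooted P

/-- The energy cap. [folklore] -/
theorem lintegral_rootKineticEnergy_le (h : IsPalmHardSphereState σ e₀ Q) :
    ∫⁻ ω, rootKineticEnergy ω ∂Q ≤ ENNReal.ofReal e₀ := by
  obtain ⟨P, -, -, -, -, -, -, hE⟩ := h
  exact hE

/-- The class grows with the energy cap. [folklore] -/
theorem mono (h : IsPalmHardSphereState σ e₀ Q) {e₁ : ℝ} (he : e₀ ≤ e₁) :
    IsPalmHardSphereState σ e₁ Q := by
  obtain ⟨P, hP, hti, hρ, hhc, hΦ, hQ, hE⟩ := h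
  exact ⟨P, hP, hti, hρ, hhc, hΦ, hQ, hE.trans (ENNReal.ofReal_le_ofReal he)⟩

/-- **The energy cap in terms of the stationary law**: for the witness `P` of a Palm hard-sphere
state, `E_Q |v_root|²/2 = kineticEnergyDensity P / σ³`, so the cap reads
`kineticEnergyDensity P ≤ σ³ e₀` (the conserved-energy cut of the route). [folklore] -/
theorem lintegral_rootKineticEnergy_eq {P : Measure (PointConfig (V3 × V3))} [IsProbabilityMeasure P]
    (hhc : ∀ᵐ ω ∂P, IsHardCore 1 ω) :
    ∫⁻ ω, rootKineticEnergy ω ∂(palmLaw P) = (intensity P)⁻¹ * kineticEnergyDensity P :=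
  lintegral_rootKineticEnergy_palmLaw P one_pos hhc

end IsPalmHardSphereState

/-- **Path-space alternative** to `IsPalmHardSphereState` (design note of the request; Alexander 1976
constructs the infinite dynamics for Gibbs states only, so for limit states of finite systems one may
prefer to carry the dynamics as a law on paths): `Q` is the time-zero Palm marginal of a probability
law `Pth` on configuration paths `γ : ℝ → PointConfig (ℝ³ × ℝ³)` (product σ-algebra) which is
stationary under the time shifts `γ ↦ γ(· + t)`, invariant under the spatial translations
`γ ↦ γ(·) + (a, 0)`, carried by paths traced by solutions of the infinite hard-sphere equations of
motion at diameter `1` (`IsInfiniteHardSphereTrajectory`) with finite collision clusters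
(`HasFiniteClusters`), whose time-zero marginal has intensity `σ³`; and `E_Q |v_root|²/2 ≤ e₀`
(hard core at all times is part of `IsInfiniteHardSphereTrajectory`). Neither weaker nor stronger
than the flow form as stated; route items should quote `IsPalmHardSphereState`. [folklore] -/
def IsPalmHardSphereTrajectoryState (σ e₀ : ℝ) (Q : Measure (PointConfig (V3 × V3))) : Prop :=
  ∃ Pth : Measure (ℝ → PointConfig (V3 × V3)), IsProbabilityMeasure Pth ∧
    (∀ t : ℝ, Pth.map (fun γ : ℝ → PointConfig (V3 × V3) => fun s => γ (s + t)) = Pth) ∧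
    (∀ a : V3, Pth.map (fun γ : ℝ → PointConfig (V3 × V3) => fun s => (γ s).translate (a, 0)) = Pth) ∧
    (∀ᵐ γ ∂ Pth, ∃ (S : Set (V3 × V3)) (x : V3 × V3 → ℝ → V3 × V3),
      IsInfiniteHardSphereTrajectory 1 S x ∧ HasFiniteClusters 1 S x ∧
        ∀ t, ((γ t : PointConfig (V3 × V3)) : Set (V3 × V3)) = (fun p => x p t) '' S) ∧
    intensity (Pth.map fun γ => γ 0) = ENNReal.ofReal (σ ^ 3) ∧
    Q = palmLaw (Pth.map fun γ => γ 0) ∧ ∫⁻ ω, rootKineticEnergy ω ∂Q ≤ ENNReal.ofReal e₀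

/-- The energy cap of the path-space form. [folklore] -/
theorem IsPalmHardSphereTrajectoryState.lintegral_rootKineticEnergy_le {σ e₀ : ℝ}
    {Q : Measure (PointConfig (V3 × V3))} (h : IsPalmHardSphereTrajectoryState σ e₀ Q) :
    ∫⁻ ω, rootKineticEnergy ω ∂Q ≤ ENNReal.ofReal e₀ := by
  obtain ⟨Pth, -, -, -, -, -, -, hE⟩ := h
  exact hE

end AdmissibleClass

end Literature.Analysis.FluidPDE
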